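import Literature.NumberTheory.GaloisCohomology.Howard2004.DVRSettingEngineAssembly
import Literature.NumberTheory.GaloisCohomology.Howard2004.DVRSettingEngineLiftKappaProofs
import HarnessLib

/-!
# Howard 2004, Lemma 1.6.4 / Thm. 1.6.1 on a full `DVRSetting`: the ENGINE assembly with the liftability case
# (`hlift`) DISCHARGED and the level letter `lam` FIXED (theorems only)

Topic `NumberTheory/GaloisCohomology/Howard2004`; namespace `Literature.NumberTheory.GaloisCohomology.Howard2004`.
THEOREMS ONLY: no definition, no named fact, no instance, no notation, no `sorry`.  Sequel to
`DVRSettingEngineAssembly` (x10b-p1-w2 g16: `kappaSel_mem_stub_of_engineInputs` / `conclusion_of_engineInputs`, the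
ENGINE instantiated on a `DVRSetting` with the seven printed inputs `hlam hlift hKS h159 hsmall hchebI hchebII` as
binders and the level letter `lam` a parameter) and `DVRSettingEngineLiftKappaProofs` (x10b-p1-w7 g9:
`kappaSel_mem_stub_of_redSel_eq_zero` = the binder `hlift` on a full tower for `lam k n := stubLength k n - 1`).

WHY (INPUTS row G87 = `Howard2004.thm161_dvrKolyvaginBound` = Howard Thm. 1.6.1; stub `stub_h161` of the μ-crux
stmt-BirchSwinnertonDyer-22642; cell `pub/bsd-print-x9`).  On a FULL tower (`e_i = i + 1`: the settings of
`thm161_of_full_tame`, `S.refine`) Howard's `i = λ^{(k)}(n)` (arXiv:1202.6340 p. 11 L87: «Let `i = λ^{(k)}(n)`») is the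
level INDEX `λ^{(k)}(n) - 1`; fixing `lam k n := S.stubLength hy hdec k n - 1` the liftability case is the tree's
`kappaSel_mem_stub_of_redSel_eq_zero`, so the assembly keeps SIX inputs:

* **`DVRSetting.kappaSel_mem_stub_of_engineInputs_of_full`** — `κ^{(k)}_n ∈ Stub^{(k)}(n)` for all `k`,
  `n ∈ 𝓝(𝓛^{(2k-1)})`, from `hlam` (at `lam = λ - 1`), `hKS`, `h159`, `hsmall`, `hchebI`, `hchebII`, given the levelwise
  structure twice: `hdec` (the engine's key, feeding `stub`/`stubLength`) and `hdecAt` (Howard's key `𝓝^{(j)}`, read at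
  the auxiliary level of exponent `2e_k - 1`);
* **`DVRSetting.conclusion_of_engineInputs_of_full`** — Thm. 1.6.1's conclusion record `S.Conclusion hy κ.one` from the
  same six inputs and `κ_1 ≠ 0`.

HONEST FRAMING: Lemma 1.6.4, Thm. 1.6.1 and `thm161_dvrKolyvaginBound` are NOT proved here (Thm. 1.4.2 — `hdec`/`hdecAt` —
and the six inputs remain hypotheses); no summit statement is proved; the Birch–Swinnerton-Dyer conjecture is not proved
by any of this.
References: [Howard2004HeegnerKolyvagin] Lemma 1.6.4 and Thm. 1.6.1 (arXiv:1202.6340 Lemma 2.6.4 / Thm. 2.6.1, p. 11 L82 –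
p. 12 L55); [MazurRubinMemoirs2004] Thm. 4.5.1, Prop. 4.5.8.
-/

set_option autoImplicit false

noncomputable section

open Function NumberField IsDedekindDomain Field
open scoped NumberField ContRepresentation Classical

namespace Literature.NumberTheory.GaloisCohomology.Howard2004

open Literature.NumberTheory.GaloisRepresentations
open Literature.NumberTheory.GaloisRepresentations.DiscreteGaloisModule

namespace DVRSetting

variable {p : ℕ} [Fact p.Prime] {K : Type} [Field K] [NumberField K]
  {R : Type} [CommRing R] [IsDomain R] [IsDiscreteValuationRing R] [Algebra ℤ_[p] R]
  {N : ℕ → Type} [∀ k, AddCommGroup (N k)] [∀ k, TopologicalSpace (N k)]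
  [∀ k, DiscreteTopology (N k)] [∀ k, Module R (N k)]
  {Rk : ℕ → Type} [∀ k, CommRing (Rk k)] [∀ k, IsLocalRing (Rk k)] [∀ k, TopologicalSpace (Rk k)]
  [∀ k, DiscreteTopology (Rk k)] [∀ k, Algebra ℤ_[p] (Rk k)] [∀ k, Algebra R (Rk k)]
  [∀ k, Module (Rk k) (N k)] [∀ k, IsScalarTower R (Rk k) (N k)]
  {Nbar : Type} [AddCommGroup Nbar] [TopologicalSpace Nbar] [DiscreteTopology Nbar]
  [∀ k, Module (Rk k) Nbar]
  {Nq : ℕ → Finset (HeightOneSpectrum (𝓞 K)) → Type} [∀ k n, AddCommGroup (Nq k n)]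
  [∀ k n, TopologicalSpace (Nq k n)] [∀ k n, DiscreteTopology (Nq k n)]
  [∀ k n, Module (Rk k) (Nq k n)] [∀ k n, Module R (Nq k n)]
  [∀ k n, IsScalarTower R (Rk k) (Nq k n)]

/-- **Howard's Lemma 1.6.4 on a FULL `DVRSetting` from SIX printed inputs** (the liftability case discharged, the level
letter fixed to `λ^{(k)}(n) - 1`): `κ^{(k)}_n ∈ Stub^{(k)}(n)` for every `k` and every `n ∈ 𝓝(𝓛^{(2k-1)})`, from
`hlam` (the liftability-case bookkeeping at `lam = λ - 1`), `hKS`, `h159`, `hsmall`, `hchebI`, `hchebII` — the binders of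
`kappaSel_mem_stub_of_engineInputs` — and the levelwise structure under both keys (`hdec`, `hdecAt`).
[cite: Howard2004HeegnerKolyvagin, Lemma 1.6.4 (arXiv Lemma 2.6.4, p. 11 L82 – p. 12 L27)] -/
theorem kappaSel_mem_stub_of_engineInputs_of_full (S : DVRSetting p K R N Rk Nbar Nq) (hy : S.SatisfiesH)
    (κ : S.KolyvaginSystem) (pins : ∀ v : HeightOneSpectrum (𝓞 K), TamePin v) (hdec : S.HasLevelDecompositions hy)
    (hdecAt : S.HasLevelDecompositionsAt hy) (hfull : ∀ i, S.e i = i + 1)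
    (ρp ρm : ℕ → Finset (HeightOneSpectrum (𝓞 K)) → ℕ) :
    letI : ∀ k, Module R (galoisCohomology (S.T.ρ k) 1) := fun k => galoisCohomology.moduleH1 (S.T.ρ k) (S.T.hlin k)
    letI : ∀ (k : ℕ) (v : Place K), Module R (galoisCohomology ((S.T.ρ k).toLocal v) 1) :=
      fun k v => galoisCohomology.moduleH1 ((S.T.ρ k).toLocal v) ((S.T.hlin k).restrictField (Place.Completion v))
    (∀ k n, ↑n ⊆ S.enginePrimes k → S.stub hy hdec k n ≠ ⊥ →
        S.stub hy hdec k n = ⊤ ∨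
          (S.stubLength hy hdec k n - 1 < k ∧ S.stub hy hdec (S.stubLength hy hdec k n - 1) n = ⊥)) →
    (∀ k n (ℓ : HeightOneSpectrum (𝓞 K)), ↑n ⊆ S.enginePrimes k → ℓ ∈ S.enginePrimes k → ℓ ∉ n →
        ((S.locR k (Sum.inr ℓ)).domRestrict (S.selmerModuleAt hy k n) (S.kappaSel hy κ pins k n) = 0 ↔
          (S.locR k (Sum.inr ℓ)).domRestrict (S.selmerModuleAt hy k (insert ℓ n))
            (S.kappaSel hy κ pins k (insert ℓ n)) = 0)) →
    (∀ k n (ℓ : HeightOneSpectrum (𝓞 K)), ↑n ⊆ S.enginePrimes k → ℓ ∈ S.enginePrimes k → ℓ ∉ n →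
        S.stub hy hdec k n ≤ LinearMap.ker ((S.locR k (Sum.inr ℓ)).domRestrict (S.selmerModuleAt hy k n)) →
          S.stub hy hdec k (insert ℓ n) ≤
            LinearMap.ker ((S.locR k (Sum.inr ℓ)).domRestrict (S.selmerModuleAt hy k (insert ℓ n)))) →
    (∀ k n, ↑n ⊆ S.enginePrimes k → ρp k n + ρm k n ≤ 1 → S.stub hy hdec k n = ⊤) →
    (∀ k n, ↑n ⊆ S.enginePrimes k → 0 < ρp k n → 0 < ρm k n → ∀ d : ↥(S.selmerModuleAt hy k n), d ≠ 0 →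
        S.π • d = 0 → ∃ ℓ ∈ S.enginePrimes k, ℓ ∉ n ∧
          (S.locR k (Sum.inr ℓ)).domRestrict (S.selmerModuleAt hy k n) d ≠ 0 ∧
            ρp k (insert ℓ n) + 1 = ρp k n ∧ ρm k (insert ℓ n) + 1 = ρm k n) →
    (∀ k n, ↑n ⊆ S.enginePrimes k → (ρm k n = 0 ∧ 2 ≤ ρp k n) ∨ (ρp k n = 0 ∧ 2 ≤ ρm k n) →
        ∀ d : ↥(S.selmerModuleAt hy k n), d ≠ 0 → S.π • d = 0 →
          ∃ ℓ ∈ S.enginePrimes k, ℓ ∉ n ∧ (S.locR k (Sum.inr ℓ)).domRestrict (S.selmerModuleAt hy k n) d ≠ 0 ∧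
            0 < ρp k (insert ℓ n) ∧ 0 < ρm k (insert ℓ n) ∧
              ρp k (insert ℓ n) + ρm k (insert ℓ n) = ρp k n + ρm k n) →
    ∀ (k : ℕ) (n : Finset (HeightOneSpectrum (𝓞 K))), ↑n ⊆ S.enginePrimes k →
      S.kappaSel hy κ pins k n ∈ S.stub hy hdec k n := by
  letI : ∀ k, Module R (galoisCohomology (S.T.ρ k) 1) := fun k => galoisCohomology.moduleH1 (S.T.ρ k) (S.T.hlin k)
  letI : ∀ (k : ℕ) (v : Place K), Module R (galoisCohomology ((S.T.ρ k).toLocal v) 1) :=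
    fun k v => galoisCohomology.moduleH1 ((S.T.ρ k).toLocal v) ((S.T.hlin k).restrictField (Place.Completion v))
  intro hlam hKS h159 hsmall hchebI hchebII k n hn
  exact S.kappaSel_mem_stub_of_engineInputs hy κ pins hdec ρp ρm (fun k n => S.stubLength hy hdec k n - 1) hlam
    (S.kappaSel_mem_stub_of_redSel_eq_zero hy hdec hdecAt hfull κ pins) hKS h159 hsmall hchebI hchebII k n hn

/-- **Howard's Thm. 1.6.1 (conclusion record `S.Conclusion hy κ.one`) on a FULL `DVRSetting` with H.0–H.5 and `κ_1 ≠ 0`,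
from the levelwise structure (both keys) and SIX printed inputs** — `conclusion_of_engineInputs` with the liftability
case `hlift` discharged (`kappaSel_mem_stub_of_redSel_eq_zero`) and `lam k n := λ^{(k)}(n) - 1`.
[cite: Howard2004HeegnerKolyvagin, Thm. 1.6.1 and Lemma 1.6.4 (arXiv Thm. 2.6.1 / Lemma 2.6.4, p. 11 L18 – p. 12 L55)] -/
theorem conclusion_of_engineInputs_of_full (S : DVRSetting p K R N Rk Nbar Nq) (hy : S.SatisfiesH)
    (κ : S.KolyvaginSystem) (pins : ∀ v : HeightOneSpectrum (𝓞 K), TamePin v) (hdec : S.HasLevelDecompositions hy)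
    (hdecAt : S.HasLevelDecompositionsAt hy) (hfull : ∀ i, S.e i = i + 1)
    (ρp ρm : ℕ → Finset (HeightOneSpectrum (𝓞 K)) → ℕ) :
    letI : ∀ k, Module R (galoisCohomology (S.T.ρ k) 1) := fun k => galoisCohomology.moduleH1 (S.T.ρ k) (S.T.hlin k)
    letI : ∀ (k : ℕ) (v : Place K), Module R (galoisCohomology ((S.T.ρ k).toLocal v) 1) :=
      fun k v => galoisCohomology.moduleH1 ((S.T.ρ k).toLocal v) ((S.T.hlin k).restrictField (Place.Completion v))
    (∀ k n, ↑n ⊆ S.enginePrimes k → S.stub hy hdec k n ≠ ⊥ →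
        S.stub hy hdec k n = ⊤ ∨
          (S.stubLength hy hdec k n - 1 < k ∧ S.stub hy hdec (S.stubLength hy hdec k n - 1) n = ⊥)) →
    (∀ k n (ℓ : HeightOneSpectrum (𝓞 K)), ↑n ⊆ S.enginePrimes k → ℓ ∈ S.enginePrimes k → ℓ ∉ n →
        ((S.locR k (Sum.inr ℓ)).domRestrict (S.selmerModuleAt hy k n) (S.kappaSel hy κ pins k n) = 0 ↔
          (S.locR k (Sum.inr ℓ)).domRestrict (S.selmerModuleAt hy k (insert ℓ n))
            (S.kappaSel hy κ pins k (insert ℓ n)) = 0)) →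
    (∀ k n (ℓ : HeightOneSpectrum (𝓞 K)), ↑n ⊆ S.enginePrimes k → ℓ ∈ S.enginePrimes k → ℓ ∉ n →
        S.stub hy hdec k n ≤ LinearMap.ker ((S.locR k (Sum.inr ℓ)).domRestrict (S.selmerModuleAt hy k n)) →
          S.stub hy hdec k (insert ℓ n) ≤
            LinearMap.ker ((S.locR k (Sum.inr ℓ)).domRestrict (S.selmerModuleAt hy k (insert ℓ n)))) →
    (∀ k n, ↑n ⊆ S.enginePrimes k → ρp k n + ρm k n ≤ 1 → S.stub hy hdec k n = ⊤) →
    (∀ k n, ↑n ⊆ S.enginePrimes k → 0 < ρp k n → 0 < ρm k n → ∀ d : ↥(S.selmerModuleAt hy k n), d ≠ 0 →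
        S.π • d = 0 → ∃ ℓ ∈ S.enginePrimes k, ℓ ∉ n ∧
          (S.locR k (Sum.inr ℓ)).domRestrict (S.selmerModuleAt hy k n) d ≠ 0 ∧
            ρp k (insert ℓ n) + 1 = ρp k n ∧ ρm k (insert ℓ n) + 1 = ρm k n) →
    (∀ k n, ↑n ⊆ S.enginePrimes k → (ρm k n = 0 ∧ 2 ≤ ρp k n) ∨ (ρp k n = 0 ∧ 2 ≤ ρm k n) →
        ∀ d : ↥(S.selmerModuleAt hy k n), d ≠ 0 → S.π • d = 0 →
          ∃ ℓ ∈ S.enginePrimes k, ℓ ∉ n ∧ (S.locR k (Sum.inr ℓ)).domRestrict (S.selmerModuleAt hy k n) d ≠ 0 ∧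
            0 < ρp k (insert ℓ n) ∧ 0 < ρm k (insert ℓ n) ∧
              ρp k (insert ℓ n) + ρm k (insert ℓ n) = ρp k n + ρm k n) →
    κ.one ≠ 0 → S.Conclusion hy κ.one := by
  letI : ∀ k, Module R (galoisCohomology (S.T.ρ k) 1) := fun k => galoisCohomology.moduleH1 (S.T.ρ k) (S.T.hlin k)
  letI : ∀ (k : ℕ) (v : Place K), Module R (galoisCohomology ((S.T.ρ k).toLocal v) 1) :=
    fun k v => galoisCohomology.moduleH1 ((S.T.ρ k).toLocal v) ((S.T.hlin k).restrictField (Place.Completion v))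
  intro hlam hKS h159 hsmall hchebI hchebII hone
  exact S.conclusion_of_engineInputs hy κ pins hdec ρp ρm (fun k n => S.stubLength hy hdec k n - 1) hlam
    (S.kappaSel_mem_stub_of_redSel_eq_zero hy hdec hdecAt hfull κ pins) hKS h159 hsmall hchebI hchebII hone

end DVRSetting

end Literature.NumberTheory.GaloisCohomology.Howard2004

end
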